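import Mathlib
import Summits.Ventures.PercRepro2.TB14MarkEdge

/-!
# The edge from the mark to its OWN root: the exact defect (typed BHK 1.4): Theorem T₁
(blind cell PercRepro2, mine-c g20, 2026-08-25; `conjectures/MINE-C.md` §29.6)

For a free edge `e = b a₁` (the mark `b` to ITS root), splitting the two-copy sum of the folded
kernel on `e` (`pairCount_foldK_markEdge`) gives the defect
`foldK (y₂[e ↦ 1]) w₂ + foldK y₂ (w₂[e ↦ 1]) − foldK y₂ w₂`.  With the edge open in the first (blue)
copy `b ∈ C_y(a₁)` holds automatically and `1_Q(y)` becomes `1_Q(y₂) 1[b ∉ C_{y₂}(a₂)]`; with the edge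
open in the second (red) copy `1_Q(w)` becomes `1_Q(w₂) 1[b ∉ C_{w₂}(a₂)]` and nothing else changes.
The defect is therefore the POINTWISE identity (`markEdgeDefect_ownRoot_eq`)

  `defect = 1_Q(y) 1_Q(w) ([b ∉ M_b] − [b ∈ K_b ∩ M_r]) ε_o = A + J`,

with `A = 1_Q 1_Q [b ∉ M_b][b ∉ M_r] ε_o` (the two-colour avoidance of the mark by the clusters of
`a₂`) and `J = 1_Q 1_Q [b ∈ M_r][b ∉ M_b][b ∉ K_b] ε_o` (the mark in the anchor status `Mr`:
red at `a₂`, outside both clusters of `a₁` and the blue cluster of `a₂`), `ε_o = 1[o ∈ C_w(a₂)] −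
1[o ∈ C_y(a₂)]`.  Hence (`pairCount_foldK_ownRootEdge`)

  `D(G; a₁, a₂, b, o) = D(G − b a₁; a₁, a₂, b, o) + A(G − b a₁) + J(G − b a₁)`

at every profile in which `b a₁` is free.  Neither `A` nor `J` is pointwise signed; both are
admissible systems of the candidate (TB-ADM′) (`TBAdm.lean`: `A` = the `a₂`-avoidance constraint,
`J` = `{∈ M_r, ∉ M_b, ∉ K_b}`), so under (TB-ADM′) the edge from the mark to its own root never hurts
(the companion file `TB14OwnRootEdgeAdm`).  Exact check `data/mine-c/g20/scripts/ownroot.py`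
(an independent brute force of `D(G)`, `D(G − e)`, `A`, `J`: every connected graph with n ≤ 6, every
marking, every free edge `b a₁` — 1,560 + 22,824 instances, 0 failures).  Own work; standard axioms.
-/

namespace Summit.Ventures.PercRepro2

namespace TB14Cut

open CovForm A3InactiveTyped

section OwnRootEdge

variable {V : Type} {E : Type} [Fintype E] [DecidableEq E] {R : Type*} [Field R]
variable {ends : E → Sym2 V} {e : E} {a₁ a₂ b o : V}

/-- The avoidance piece of the defect of the edge `b a₁`: the mark outside both clusters of `a₂`
(first copy `y` blue, second copy `w` red). -/
noncomputable def ownRootAvoid (ends : E → Sym2 V) (a₁ a₂ b o : V) : Config E → Config E → R :=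
  fun y w => iQ ends a₁ a₂ y * iQ ends a₁ a₂ w * (1 - iH ends a₂ b y) * (1 - iH ends a₂ b w) *
    (iH ends a₂ o w - iH ends a₂ o y)

/-- The anchor piece of the defect of the edge `b a₁`: the mark red at `a₂`, outside the blue
cluster of `a₂` and the blue cluster of `a₁` (the status `Mr`). -/
noncomputable def ownRootAnchor (ends : E → Sym2 V) (a₁ a₂ b o : V) : Config E → Config E → R :=
  fun y w => iQ ends a₁ a₂ y * iQ ends a₁ a₂ w * iH ends a₂ b w * (1 - iH ends a₂ b y) *
    (1 - iL ends a₁ b y) * (iH ends a₂ o w - iH ends a₂ o y)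

omit [Fintype E] in
/-- The Boolean core of Theorem T₁.  `A1 = a₁ ↔_y a₂`, `A2 = a₁ ↔_w a₂`, `B1 = a₁ ↔_y b`,
`C1 = a₂ ↔_y b`, `C2 = a₂ ↔_w b`, `O1 = a₂ ↔_y o`, `O2 = a₂ ↔_w o`; `P1, R1, P2, R2` the
connections through the new edge (`a₁ ↔ o`, `b ↔ o` in either copy) and `Q1, Q2` the reversed
root connections; the hypotheses are transitivity. -/
lemma ownRoot_key (A1 A2 B1 C1 C2 O1 O2 P1 R1 P2 R2 Q1 Q2 : Prop) [Decidable A1] [Decidable A2]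
    [Decidable B1] [Decidable C1] [Decidable C2] [Decidable O1] [Decidable O2] [Decidable P1]
    [Decidable R1] [Decidable P2] [Decidable R2] [Decidable Q1] [Decidable Q2]
    (hQ1 : Q1 → A1) (hQ2 : Q2 → A2) (hBC : B1 → C1 → A1) :
    (if A1 ∨ C1 then (0 : R) else 1) * (if A2 then 0 else 1) * 1 *
          ((if O2 then 1 else 0) - (if O1 ∨ (C1 ∧ P1) ∨ (Q1 ∧ R1) then 1 else 0)) +
        (if A1 then 0 else 1) * (if A2 ∨ C2 then 0 else 1) * (if B1 then 1 else 0) *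
          ((if O2 ∨ (C2 ∧ P2) ∨ (Q2 ∧ R2) then 1 else 0) - (if O1 then 1 else 0)) -
        (if A1 then 0 else 1) * (if A2 then 0 else 1) * (if B1 then 1 else 0) *
          ((if O2 then 1 else 0) - (if O1 then 1 else 0)) =
      (if A1 then 0 else 1) * (if A2 then 0 else 1) * (1 - (if C1 then 1 else 0)) *
          (1 - (if C2 then 1 else 0)) * ((if O2 then 1 else 0) - (if O1 then 1 else 0)) +
        (if A1 then 0 else 1) * (if A2 then 0 else 1) * (if C2 then 1 else 0) *
          (1 - (if C1 then 1 else 0)) * (1 - (if B1 then 1 else 0)) *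
          ((if O2 then 1 else 0) - (if O1 then 1 else 0)) := by
  by_cases hA1 : A1
  · simp [hA1]
  by_cases hA2 : A2
  · simp [hA2]
  have hQ1' : ¬ Q1 := fun h => hA1 (hQ1 h)
  have hQ2' : ¬ Q2 := fun h => hA2 (hQ2 h)
  by_cases hC1 : C1
  · have hB1 : ¬ B1 := fun h => hA1 (hBC h hC1)
    by_cases hC2 : C2
    · simp [hA1, hA2, hC1, hC2, hB1]
    · simp [hA1, hA2, hC1, hC2, hB1, hQ2']
  · by_cases hC2 : C2
    · by_cases hB1 : B1
      · simp [hA1, hA2, hC1, hC2, hQ1', hB1]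
      · simp [hA1, hA2, hC1, hC2, hQ1', hB1]
    · simp [hA1, hA2, hC1, hC2, hQ1', hQ2']

omit [Fintype E] in
/-- The defect of the edge `b a₁` at a pair with the edge closed in both copies is `A + J`. -/
lemma markEdgeDefect_ownRoot_eq (he : ends e = s(b, a₁)) (y₂ w₂ : Config E) (hy : y₂ e = false)
    (hw : w₂ e = false) :
    (markEdgeDefect ends e a₁ a₂ b o y₂ w₂ : R) =
      ownRootAvoid ends a₁ a₂ b o y₂ w₂ + ownRootAnchor ends a₁ a₂ b o y₂ w₂ := by
  classical
  have hy' := conn_update_true_iff (ends := ends) he hy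
  have hw' := conn_update_true_iff (ends := ends) he hw
  have hab : Conn ends (Function.update y₂ e true) a₁ b :=
    conn_symm (conn_of_openAdj ⟨e, Function.update_self e true y₂, he⟩)
  have hQy' : Conn ends (Function.update y₂ e true) a₁ a₂ ↔
      Conn ends y₂ a₁ a₂ ∨ Conn ends y₂ a₂ b := by
    rw [hy' a₁ a₂]
    constructor
    · rintro (h | ⟨_, h2⟩ | ⟨_, h2⟩)
      · exact Or.inl h
      · exact Or.inl h2
      · exact Or.inr (conn_symm h2)
    · rintro (h | h)
      · exact Or.inl h
      · exact Or.inr (Or.inr ⟨conn_refl _ _ _, conn_symm h⟩)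
  have hQw' : Conn ends (Function.update w₂ e true) a₁ a₂ ↔
      Conn ends w₂ a₁ a₂ ∨ Conn ends w₂ a₂ b := by
    rw [hw' a₁ a₂]
    constructor
    · rintro (h | ⟨_, h2⟩ | ⟨_, h2⟩)
      · exact Or.inl h
      · exact Or.inl h2
      · exact Or.inr (conn_symm h2)
    · rintro (h | h)
      · exact Or.inl h
      · exact Or.inr (Or.inr ⟨conn_refl _ _ _, conn_symm h⟩)
  have hHy' : Conn ends (Function.update y₂ e true) a₂ o ↔
      Conn ends y₂ a₂ o ∨ (Conn ends y₂ a₂ b ∧ Conn ends y₂ a₁ o) ∨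
        (Conn ends y₂ a₂ a₁ ∧ Conn ends y₂ b o) := hy' a₂ o
  have hHw' : Conn ends (Function.update w₂ e true) a₂ o ↔
      Conn ends w₂ a₂ o ∨ (Conn ends w₂ a₂ b ∧ Conn ends w₂ a₁ o) ∨
        (Conn ends w₂ a₂ a₁ ∧ Conn ends w₂ b o) := hw' a₂ o
  simp only [markEdgeDefect, foldK, ownRootAvoid, ownRootAnchor, iQ_eq_ite', iL_eq_ite',
    iH_eq_ite', hQy', hQw', hHy', hHw', if_pos hab]
  exact ownRoot_key (Conn ends y₂ a₁ a₂) (Conn ends w₂ a₁ a₂) (Conn ends y₂ a₁ b)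
    (Conn ends y₂ a₂ b) (Conn ends w₂ a₂ b) (Conn ends y₂ a₂ o) (Conn ends w₂ a₂ o)
    (Conn ends y₂ a₁ o) (Conn ends y₂ b o) (Conn ends w₂ a₁ o) (Conn ends w₂ b o)
    (Conn ends y₂ a₂ a₁) (Conn ends w₂ a₂ a₁) (fun h => conn_symm h) (fun h => conn_symm h)
    (fun h1 h2 => conn_trans h1 (conn_symm h2))

/-- **THEOREM T₁ — the exact defect of the edge from the mark to its own root**:
`D(G) = D(G − b a₁) + A + J` at every profile in which `b a₁` is free, `A` the two-colour
avoidance count of the mark by the clusters of `a₂` and `J` the anchor count (`b` in the status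
`Mr`), both at the profile with the edge closed. -/
theorem pairCount_foldK_ownRootEdge (he : ends e = s(b, a₁)) (F : Finset E) (z : Config E)
    (heF : e ∈ F) :
    pairCount F z (foldK ends a₁ a₂ b o : Config E → Config E → R) =
      pairCount (F.erase e) (Function.update z e false) (foldK ends a₁ a₂ b o) +
        pairCount (F.erase e) (Function.update z e false) (ownRootAvoid ends a₁ a₂ b o) +
        pairCount (F.erase e) (Function.update z e false) (ownRootAnchor ends a₁ a₂ b o) := by
  classical
  rw [pairCount_foldK_markEdge F z heF, add_assoc]
  congr 1
  unfold pairCount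
  rw [← Finset.sum_add_distrib]
  refine Finset.sum_congr rfl fun y₂ _ => ?_
  by_cases hadm : ∀ f, f ∉ F.erase e → y₂ f = Function.update z e false f
  · rw [if_pos hadm, if_pos hadm, if_pos hadm]
    have hy₂ : y₂ e = false := by
      have := hadm e (Finset.notMem_erase e F)
      rwa [Function.update_self] at this
    have hw₂ : A3InactiveTyped.flipOn (F.erase e) y₂ e = false := by
      rw [A3InactiveTyped.flipOn_of_notMem (Finset.notMem_erase e F)]; exact hy₂
    exact markEdgeDefect_ownRoot_eq he y₂ _ hy₂ hw₂
  · rw [if_neg hadm, if_neg hadm, if_neg hadm, add_zero]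

end OwnRootEdge

end TB14Cut

end Summit.Ventures.PercRepro2
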